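import Mathlib
import HarnessLib
import Summits.Ventures.LatticeQCDFlow.Exactness.StdGaussianRadial
import Summits.Ventures.LatticeQCDFlow.Exactness.U1ExpChartMinorisation

/-!
# The `cpn_2d` Metropolis proposals dominate the uniform laws: the angular-Gaussian site kick and the wrapped-Gaussian link kick are one-step Doeblin

HONEST FRAMING: exact (Metropolis-corrected) sampling algorithms for lattice gauge theory;
figures of merit are autocorrelation/cost numbers at stated couplings and volumes; no
continuum-physics claim.

Venture `LatticeQCDFlow` (cell pub-lqcd), topic `Exactness`, FANOUT row 9 (eng-latcore, the
engine `latflow.core.cpn_2d` in mode `'metro'`: `metropolis_sites` proposes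
`z ← (z + ε η)/|z + ε η|` with `η` a standard complex Gaussian vector of `ℂ^N ≅ ℝ^{2N}`, and
`metropolis_links` proposes `u ← u e^{iεξ}` with `ξ` a standard real Gaussian).  NEW WORK of the cell
over the tree (`StdGaussianRadial.lean`: `stdGaussian = gaussRadial ‖·‖ · volume`;
`RadialPolar.lean`: the direction of a radially weighted Haar measure is `uniformSphere`;
`U1ExpChartMinorisation.lean`: `(2π/ε) • Haar_{U(1)} ≤ (dθ|_{|θ|<π/ε}) ∘ (θ ↦ e^{iεθ})⁻¹`; Mathlib
`addHaar_preimage_smul`, `measure_preimage_add`, `gaussianReal = gaussianPDF · volume`); nothing is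
cited as a fact.  TYPED-EXACTNESS-MAP (gen-14/15): "CP(N−1)/sphere site Metropolis: NOT typed".

THE POINT.  Both proposals have laws dominating a constant multiple of the uniform reference from
EVERY current state — the one-step Doeblin input of a Metropolis-site-scan ergodicity proof — and
neither needs a density formula: the shifted Gaussian `z + εη` dominates a multiple of Lebesgue on
the unit ball (its density there is at least `gaussRadial(2/ε)`, as `|η| < 2/ε`), and Lebesgue on a
ball is radially weighted, so its direction is EXACTLY uniform (`map_dirSphere_radial`).

* §1 `angularGaussKick ε z := (stdGaussian E).map (η ↦ dirSphere (z + ε η))` — the site proposal law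
  (a probability law); `gaussRadial_antitone`; `volume_preimage_affine`;
  `map_dirSphere_restrict_ball` (`(vol|_{B(0,1)}) ∘ dirSphere⁻¹ = vol(B(0,1)) • uniformSphere`);
  **`smul_uniformSphere_le_angularGaussKick`** — for `ε > 0` and every `|z| ≤ 1`:
  `(gaussRadial_d(2/ε) · |ε^{−d}| · vol B(0,1)) • uniformSphere ≤ angularGaussKick ε z`.
* §2 `circleGaussKick ε u := (gaussianReal 0 1).map (θ ↦ u · e^{iεθ})` — the link proposal law;
  **`smul_haarProbability_le_circleGaussKick`** — for `ε > 0` and every `u ∈ U(1)`: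
  `(gaussianPDFReal 0 1 (π/ε) · 2π/ε) • Haar_{U(1)} ≤ circleGaussKick ε u`.

NOT CLAIMED: the symmetry of the angular-Gaussian kernel with respect to the uniform sphere measure
(the exactness of the site Metropolis hit — its density is a function of `⟨z, z'⟩`, not derived
here), the Metropolis sweep and its ergodicity (assembly as in `CPNHeatBathErgodic.lean`, to do);
any sharp constant.
-/

noncomputable section

namespace Summit.Ventures.LatticeQCDFlow.Exactness

open MeasureTheory Measure Metric Set ProbabilityTheory Function
open scoped ENNReal NNReal

/-! ## §1 The angular-Gaussian site kick -/

section Site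

variable {ι : Type*} [Fintype ι] [Nonempty ι]

/-- The Gaussian radial profile is antitone in the radius (on `r ≥ 0`). -/
theorem gaussRadial_antitone (d : ℕ) {r s : ℝ} (hr : 0 ≤ r) (hrs : r ≤ s) : gaussRadial d s ≤ gaussRadial d r := by
  unfold gaussRadial
  refine ENNReal.ofReal_le_ofReal (mul_le_mul_of_nonneg_left (Real.exp_le_exp.2 ?_) (by positivity))
  have : r ^ 2 ≤ s ^ 2 := pow_le_pow_left₀ hr hrs 2
  linarith

/-- **The site proposal law of `cpn_2d.metropolis_sites`**: the direction of `z + ε η`, `η` standard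
Gaussian (the angular-Gaussian kick). -/
def angularGaussKick (ε : ℝ) (z : EuclideanSpace ℝ ι) : Measure (sphere (0 : EuclideanSpace ℝ ι) 1) :=
  (stdGaussian (EuclideanSpace ℝ ι)).map fun η => dirSphere (z + ε • η)

omit [Nonempty ι] in
/-- The affine map `η ↦ z + ε η` is measurable. -/
theorem measurable_affineKick (ε : ℝ) (z : EuclideanSpace ℝ ι) : Measurable fun η : EuclideanSpace ℝ ι => z + ε • η :=
  (measurable_const_smul ε).const_add z

/-- The site proposal law is a probability law. -/
instance isProbabilityMeasure_angularGaussKick (ε : ℝ) (z : EuclideanSpace ℝ ι) :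
    IsProbabilityMeasure (angularGaussKick ε z) :=
  Measure.isProbabilityMeasure_map (measurable_dirSphere.comp (measurable_affineKick ε z)).aemeasurable

omit [Nonempty ι] in
/-- Lebesgue measure of an affine preimage: `vol ((z + ε ·)⁻¹ D) = |ε^{−d}| vol D` (`ε ≠ 0`). -/
theorem volume_preimage_affine {ε : ℝ} (hε : ε ≠ 0) (z : EuclideanSpace ℝ ι) (D : Set (EuclideanSpace ℝ ι)) :
    volume ((fun η : EuclideanSpace ℝ ι => z + ε • η) ⁻¹' D) =
      ENNReal.ofReal |(ε ^ Module.finrank ℝ (EuclideanSpace ℝ ι))⁻¹| * volume D := by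
  have hcomp : (fun η : EuclideanSpace ℝ ι => z + ε • η) ⁻¹' D =
      (fun η : EuclideanSpace ℝ ι => ε • η) ⁻¹' ((fun x : EuclideanSpace ℝ ι => z + x) ⁻¹' D) := rfl
  rw [hcomp, Measure.addHaar_preimage_smul volume hε, measure_preimage_add]

/-- **Lebesgue on the unit ball, read through the direction, is `vol(B(0,1)) •` the uniform sphere law**
(a radially weighted Haar measure has a uniform, radius-independent direction). -/
theorem map_dirSphere_restrict_ball :
    ((volume : Measure (EuclideanSpace ℝ ι)).restrict (ball 0 1)).map dirSphere =
      volume (ball (0 : EuclideanSpace ℝ ι) 1) • uniformSphere (volume : Measure (EuclideanSpace ℝ ι)) := by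
  have hφ : Measurable fun r : ℝ => (Iio (1 : ℝ)).indicator (1 : ℝ → ℝ≥0∞) r :=
    measurable_one.indicator measurableSet_Iio
  have hset : (fun y : EuclideanSpace ℝ ι => (Iio (1 : ℝ)).indicator (1 : ℝ → ℝ≥0∞) ‖y‖) =
      (ball (0 : EuclideanSpace ℝ ι) 1).indicator 1 := by
    funext y
    by_cases hy : y ∈ ball (0 : EuclideanSpace ℝ ι) 1
    · rw [indicator_of_mem hy, indicator_of_mem (by simpa [mem_ball_zero_iff] using hy)]; rfl
    · rw [indicator_of_notMem hy, indicator_of_notMem (by simpa [mem_ball_zero_iff] using hy)]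
  have hwd : (volume : Measure (EuclideanSpace ℝ ι)).withDensity
      (fun y => (Iio (1 : ℝ)).indicator (1 : ℝ → ℝ≥0∞) ‖y‖) = volume.restrict (ball 0 1) := by
    rw [hset, withDensity_indicator_one measurableSet_ball]
  haveI : IsFiniteMeasure ((volume : Measure (EuclideanSpace ℝ ι)).withDensity
      fun y => (Iio (1 : ℝ)).indicator (1 : ℝ → ℝ≥0∞) ‖y‖) := by
    rw [hwd]; exact ⟨by rw [Measure.restrict_apply_univ]; exact measure_ball_lt_top⟩
  have h := map_dirSphere_radial (μ := (volume : Measure (EuclideanSpace ℝ ι))) hφ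
  rwa [hwd, Measure.restrict_apply_univ] at h

/-- **THE SITE KICK IS ONE-STEP DOEBLIN**: for `ε > 0` and every `|z| ≤ 1`,
`(gaussRadial_d(2/ε) · |ε^{−d}| · vol B(0,1)) • uniformSphere ≤ angularGaussKick ε z`
(`d = |ι|`): from every point of the sphere the proposal dominates a fixed multiple of the uniform law. -/
theorem smul_uniformSphere_le_angularGaussKick {ε : ℝ} (hε : 0 < ε) {z : EuclideanSpace ℝ ι} (hz : ‖z‖ ≤ 1) :
    (gaussRadial (Fintype.card ι) (2 / ε) *
        (ENNReal.ofReal |(ε ^ Module.finrank ℝ (EuclideanSpace ℝ ι))⁻¹| * volume (ball (0 : EuclideanSpace ℝ ι) 1))) •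
      uniformSphere (volume : Measure (EuclideanSpace ℝ ι)) ≤ angularGaussKick ε z := by
  have hTm : Measurable fun η : EuclideanSpace ℝ ι => z + ε • η := measurable_affineKick ε z
  have hFm : Measurable fun η : EuclideanSpace ℝ ι => dirSphere (z + ε • η) := measurable_dirSphere.comp hTm
  refine Measure.le_iff.2 fun A hA => ?_
  have hAm : MeasurableSet (dirSphere ⁻¹' A : Set (EuclideanSpace ℝ ι)) := measurable_dirSphere hA
  have hDm : MeasurableSet (dirSphere ⁻¹' A ∩ ball (0 : EuclideanSpace ℝ ι) 1) := hAm.inter measurableSet_ball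
  rw [angularGaussKick, Measure.map_apply hFm hA, Measure.smul_apply, smul_eq_mul]
  -- on the preimage of the unit ball the Gaussian density is at least `gaussRadial(2/ε)`
  have hdens : ∀ η ∈ (fun η : EuclideanSpace ℝ ι => z + ε • η) ⁻¹' (dirSphere ⁻¹' A ∩ ball 0 1),
      gaussRadial (Fintype.card ι) (2 / ε) ≤ gaussRadial (Fintype.card ι) ‖η‖ := by
    intro η hη
    have hball : ‖z + ε • η‖ < 1 := mem_ball_zero_iff.1 hη.2
    refine gaussRadial_antitone _ (norm_nonneg _) ?_
    have h1 : ‖ε • η‖ ≤ ‖z + ε • η‖ + ‖z‖ := by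
      calc ‖ε • η‖ = ‖(z + ε • η) - z‖ := by rw [add_sub_cancel_left]
        _ ≤ ‖z + ε • η‖ + ‖z‖ := norm_sub_le _ _
    rw [norm_smul, Real.norm_of_nonneg hε.le] at h1
    rw [le_div_iff₀ hε, mul_comm]
    linarith
  -- the uniform law on the sphere, read back on the ball
  have hball : volume (dirSphere ⁻¹' A ∩ ball (0 : EuclideanSpace ℝ ι) 1) =
      volume (ball (0 : EuclideanSpace ℝ ι) 1) * uniformSphere (volume : Measure (EuclideanSpace ℝ ι)) A := by
    have h := congrArg (fun m : Measure (sphere (0 : EuclideanSpace ℝ ι) 1) => m A) (map_dirSphere_restrict_ball (ι := ι))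
    simp only [Measure.map_apply measurable_dirSphere hA, Measure.restrict_apply hAm, Measure.smul_apply, smul_eq_mul] at h
    exact h
  calc gaussRadial (Fintype.card ι) (2 / ε) *
        (ENNReal.ofReal |(ε ^ Module.finrank ℝ (EuclideanSpace ℝ ι))⁻¹| * volume (ball (0 : EuclideanSpace ℝ ι) 1)) *
        uniformSphere volume A
      = gaussRadial (Fintype.card ι) (2 / ε) *
          volume ((fun η : EuclideanSpace ℝ ι => z + ε • η) ⁻¹' (dirSphere ⁻¹' A ∩ ball 0 1)) := by
        rw [volume_preimage_affine hε.ne' z, hball]; ring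
    _ = ∫⁻ _ in (fun η : EuclideanSpace ℝ ι => z + ε • η) ⁻¹' (dirSphere ⁻¹' A ∩ ball 0 1),
          gaussRadial (Fintype.card ι) (2 / ε) ∂volume := (setLIntegral_const _ _).symm
    _ ≤ ∫⁻ η in (fun η : EuclideanSpace ℝ ι => z + ε • η) ⁻¹' (dirSphere ⁻¹' A ∩ ball 0 1),
          gaussRadial (Fintype.card ι) ‖η‖ ∂volume := setLIntegral_mono' (hDm.preimage hTm) hdens
    _ = stdGaussian (EuclideanSpace ℝ ι) ((fun η : EuclideanSpace ℝ ι => z + ε • η) ⁻¹' (dirSphere ⁻¹' A ∩ ball 0 1)) := by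
        rw [stdGaussian_eq_withDensity_radial, withDensity_apply _ (hDm.preimage hTm)]
    _ ≤ stdGaussian (EuclideanSpace ℝ ι) ((fun η : EuclideanSpace ℝ ι => dirSphere (z + ε • η)) ⁻¹' A) :=
        measure_mono fun η hη => hη.1

end Site

/-! ## §2 The wrapped-Gaussian link kick -/

section Link

/-- **The link proposal law of `cpn_2d.metropolis_links`**: `u ← u · e^{iεξ}`, `ξ` standard Gaussian. -/
def circleGaussKick (ε : ℝ) (u : Circle) : Measure Circle :=
  (gaussianReal 0 1).map fun θ => u * Circle.exp (ε * θ)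

/-- The link proposal law is a probability law. -/
instance isProbabilityMeasure_circleGaussKick (ε : ℝ) (u : Circle) : IsProbabilityMeasure (circleGaussKick ε u) :=
  Measure.isProbabilityMeasure_map
    ((Circle.exp.continuous.comp (continuous_const.mul continuous_id)).measurable.const_mul u).aemeasurable

/-- The standard Gaussian dominates its density at `R` times Lebesgue on `|θ| < R`. -/
theorem smul_restrict_ball_le_gaussianReal (R : ℝ) :
    ENNReal.ofReal (gaussianPDFReal 0 1 R) • (volume : Measure ℝ).restrict (ball 0 R) ≤ gaussianReal 0 1 := by
  rw [gaussianReal_of_var_ne_zero 0 one_ne_zero, ← withDensity_const]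
  calc ((volume : Measure ℝ).restrict (ball 0 R)).withDensity (fun _ => ENNReal.ofReal (gaussianPDFReal 0 1 R))
      ≤ ((volume : Measure ℝ).restrict (ball 0 R)).withDensity (gaussianPDF 0 1) := by
        refine withDensity_mono ((ae_restrict_iff' measurableSet_ball).2 (Filter.Eventually.of_forall fun θ hθ => ?_))
        rw [gaussianPDF]
        refine ENNReal.ofReal_le_ofReal ?_
        simp only [gaussianPDFReal, NNReal.coe_one, mul_one, sub_zero]
        refine mul_le_mul_of_nonneg_left (Real.exp_le_exp.2 ?_) (by positivity)
        have hθ' : |θ| < R := by simpa [mem_ball_zero_iff] using hθ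
        have : θ ^ 2 ≤ R ^ 2 := by
          rw [← sq_abs θ]; exact pow_le_pow_left₀ (abs_nonneg θ) hθ'.le 2
        linarith
    _ = ((volume : Measure ℝ).withDensity (gaussianPDF 0 1)).restrict (ball 0 R) :=
        (restrict_withDensity measurableSet_ball _).symm
    _ ≤ (volume : Measure ℝ).withDensity (gaussianPDF 0 1) := Measure.restrict_le_self

/-- **THE LINK KICK IS ONE-STEP DOEBLIN**: for `ε > 0` and every `u ∈ U(1)`,
`(gaussianPDFReal 0 1 (π/ε) · 2π/ε) • Haar_{U(1)} ≤ circleGaussKick ε u`. -/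
theorem smul_haarProbability_le_circleGaussKick {ε : ℝ} (hε : 0 < ε) (u : Circle) :
    (ENNReal.ofReal (gaussianPDFReal 0 1 (Real.pi / ε)) * ENNReal.ofReal (2 * Real.pi / ε)) •
        Literature.MathematicalPhysics.QuantumFieldTheory.haarProbability Circle ≤ circleGaussKick ε u := by
  have hmexp : Measurable fun θ : ℝ => Circle.exp (ε * θ) :=
    (Circle.exp.continuous.comp (continuous_const.mul continuous_id)).measurable
  have hcomp : (fun θ : ℝ => u * Circle.exp (ε * θ)) = (fun g : Circle => u * g) ∘ fun θ : ℝ => Circle.exp (ε * θ) := rfl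
  rw [circleGaussKick, hcomp, ← Measure.map_map (measurable_const_mul u) hmexp]
  have hle : (ENNReal.ofReal (gaussianPDFReal 0 1 (Real.pi / ε)) * ENNReal.ofReal (2 * Real.pi / ε)) •
      Literature.MathematicalPhysics.QuantumFieldTheory.haarProbability Circle ≤
      (gaussianReal 0 1).map fun θ : ℝ => Circle.exp (ε * θ) := by
    have h1 := smul_haarProbability_circle_le_map_exp_mul hε
    have h2 := Measure.map_mono (smul_restrict_ball_le_gaussianReal (Real.pi / ε)) hmexp
    rw [Measure.map_smul] at h2
    rw [mul_smul]
    refine le_trans ?_ h2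
    refine Measure.le_iff'.2 fun A => ?_
    have h1A := Measure.le_iff'.1 h1 A
    simp only [Measure.smul_apply, smul_eq_mul] at h1A ⊢
    exact mul_le_mul' le_rfl h1A
  calc (ENNReal.ofReal (gaussianPDFReal 0 1 (Real.pi / ε)) * ENNReal.ofReal (2 * Real.pi / ε)) •
        Literature.MathematicalPhysics.QuantumFieldTheory.haarProbability Circle
      = ((ENNReal.ofReal (gaussianPDFReal 0 1 (Real.pi / ε)) * ENNReal.ofReal (2 * Real.pi / ε)) •
          Literature.MathematicalPhysics.QuantumFieldTheory.haarProbability Circle).map (fun g : Circle => u * g) := by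
        rw [Measure.map_smul, map_mul_left_eq_self]
    _ ≤ ((gaussianReal 0 1).map fun θ : ℝ => Circle.exp (ε * θ)).map (fun g : Circle => u * g) :=
        Measure.map_mono hle (measurable_const_mul u)

end Link

end Summit.Ventures.LatticeQCDFlow.Exactness
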